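import Summits.QuantumFields.BalabanUV.T4Continuum.Support.VectorGaugeCovarianceSlice
import Summits.QuantumFields.BalabanUV.T4Continuum.Support.VariationalVectorTower
import Literature.Analysis.Complex.LoewnerCriteria

/-!
# T⁴ programme, spine node NE2 (U1a), lane P2 — «V-GAUGE-COV», file 3: THE EFFECTIVE OPERATOR IS GAUGE-COVARIANT — `X^V(R^u, Gm^u, Q_{T^g}) = V·X^V(R, Gm, Q_T)·Vᴴ`
# with the UNIT-LATTICE rotation `V` (model level, `E = ℂ`; cell `pub-balaban`)

NE2 formalisation swarm `b2b-balaban-t4-ne2-formalise-*`, leaf prover 03 GEN 7 (`prover-b2b-balaban-t4-ne2-formalise-leaf-03-g7-0`); register row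
«P2-sup» of `t4/formal/NE2/LEAVES.md`; journal INTENT «V-GAUGE-COV» CLAIMS.log l.19543.  On top of files 1 ∕ 1b ∕ 2 (`VectorGaugeCovariance*`: `gaugeR`, `gaugeW`,
`gaugeL`, `curlSq_gauge`, `QvL_gauge`) and of the road owner's `VariationalVectorEffective.{Kcurl, KV, effV, unc, cur, qform_Kcurl}` ∕ `VariationalEffectiveOperator.{Ka, Ca,
effOp, eq_of_forms_eq}` ∕ `VariationalVectorTower.{QmL, QmL_mulVec}` BY NAME; the tree's `Literature.Analysis.Complex.qform_conj`.
 * §1 `E = ℂ`: a unitary `u x : ℂ →L[ℂ] ℂ` is multiplication by the phase `u x 1` (`apply_eq_phase_mul`, `norm_phase`, `star_apply_eq`); the DIAGONAL PHASE MATRICES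
   `phaseM N u := diagonal (p ↦ u p.1 1)` on the product index (one DATA `def`), unitary (`phaseM_conjTranspose_mul`, `phaseM_mul_conjTranspose`), and
   `unc (gaugeW u W) = phaseM u *ᵥ unc W`, `cur ((phaseM u)ᴴ *ᵥ w) = gaugeW u⋆ (cur w)`;
 * §2 the matrices of the road are CONJUGATED: `Kcurl (R^u) = U·Kcurl R·Uᴴ` (via `eq_of_forms_eq` + `curlSq_gauge`), `KV (R^u) (U Gm Uᴴ) = U·KV R Gm·Uᴴ`,
   `QmL (gaugeL v u T) = V·QmL T·Uᴴ` (via `QmL_mulVec` + `QvL_gauge`);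
 * §3 abstract: `(U A Uᴴ)⁻¹ = U A⁻¹ Uᴴ` for unitary `U` (both branches of Mathlib's `Matrix.inv`), hence `Ka` ∕ `Ca` ∕ **`effOp (U K Uᴴ) (V Q Uᴴ) a = V·effOp K Q a·Vᴴ`**;
 * §4 **`effV_gauge`**: `effV n M (gaugeR u R) (U Gm Uᴴ) (QmL (gaugeL v u T)) a = V * effV n M R Gm (QmL T) a * Vᴴ` — UNCONDITIONAL (no surjectivity ∕ coercivity
   hypothesis), `U = phaseM (fine n M) u`, `V = phaseM M v`; PSD ∕ form bookkeeping for the conjugated `Gm` (`posSemidef_conj`, `qform_conj_unc`).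
File 4 (`VectorGaugeCovarianceEnd`): the displayed binders are gauge-invariant statements and the GAUGE-ORBIT TRANSFER of the monotone END's conclusion.

HONEST FRAMING (T4-DAG p. 1).  Model level (c5), `E = ℂ`; [folklore] matrix algebra, NO analytic content; gauge EXISTENCE not claimed; one data `def` (`phaseM`), no
`def … : Prop`, no `sorry`; axioms standard.  V-END with background ∕ NE2 NOT proved; NE3 OPEN; spine PROVED 0∕9 unchanged; rung (B)+1 on a fixed finite T⁴ — NOT
infinite volume, NOT mass gap, NOT Clay.  HONEST DEPENDENCY (cell, verbatim): continuum YM on T⁴ ⇐ BetaPertH ∧ nine spine estimates (0/9 proved); BetaPertH ⇐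
(D1) ∧ (D4) ∧ CAP+tail; G-an2-4 gates asym, D1 and NE2/3/4.
-/

noncomputable section

namespace Summit.QuantumFields.BalabanUV.T4Continuum.VectorGaugeCovariance

open Finset Matrix
open scoped BigOperators Matrix ComplexConjugate ComplexOrder
open Literature.MathematicalPhysics.QuantumFieldTheory.Balaban1983to89.B5Prop11Plancherel (Tor fine unitVec)
open Literature.Analysis.Complex (qform qform_conj)
open Summit.QuantumFields.BalabanUV.T4Continuum.VariationalVectorForm (curlSq)
open Summit.QuantumFields.BalabanUV.T4Continuum.VariationalVectorEffective (unc cur unc_cur cur_unc Kcurl Kcurl_posSemidef qform_Kcurl KV effV)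
open Summit.QuantumFields.BalabanUV.T4Continuum.VariationalEffectiveOperator (Ka Ca effOp eq_of_forms_eq)
open Summit.QuantumFields.BalabanUV.T4Continuum.VectorBlockTrialForm (QvL)
open Summit.QuantumFields.BalabanUV.T4Continuum.VariationalVectorTower (QmL QmL_mulVec)

variable {d : ℕ}

/-! ## §1 `E = ℂ`: unitary site fields are phases; the diagonal phase matrices -/

section Phase

variable {ι : Type*} {u : ι → (ℂ →L[ℂ] ℂ)} (hu : ∀ x, u x ∈ unitary (ℂ →L[ℂ] ℂ))

omit hu in
/-- a `ℂ`-linear map of `ℂ` is multiplication by its value at `1`. [folklore] -/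
theorem apply_eq_phase_mul (x : ι) (z : ℂ) : u x z = u x 1 * z := by
  have h : u x (z • (1 : ℂ)) = z • u x 1 := map_smul _ _ _
  rw [smul_eq_mul, mul_one, smul_eq_mul] at h
  rw [h, mul_comm]

include hu

/-- the phase has modulus one. [folklore] -/
theorem norm_phase (x : ι) : ‖u x 1‖ = 1 := by rw [norm_apply hu, norm_one]

/-- `conj (u x 1) * u x 1 = 1`. [folklore] -/
theorem conj_phase_mul_phase (x : ι) : conj (u x 1) * u x 1 = 1 := by
  rw [Complex.conj_mul', norm_phase hu]; norm_num

/-- `u x 1 * conj (u x 1) = 1`. [folklore] -/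
theorem phase_mul_conj_phase (x : ι) : u x 1 * conj (u x 1) = 1 := by rw [mul_comm, conj_phase_mul_phase hu]

/-- the adjoint is multiplication by the conjugate phase: `(u x)⋆ z = conj (u x 1) * z`. [folklore] -/
theorem star_apply_eq (x : ι) (z : ℂ) : star (u x) z = conj (u x 1) * z := by
  have h : star (u x) (u x (conj (u x 1) * z)) = conj (u x 1) * z := star_apply_apply hu x _
  rw [apply_eq_phase_mul (u := u) x (conj (u x 1) * z), ← mul_assoc, phase_mul_conj_phase hu, one_mul] at h
  exact h

end Phase

section PhaseMatrix

variable (N : Fin d → ℕ) [∀ μ, NeZero (N μ)]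

/-- **THE DIAGONAL PHASE MATRIX** of a site field on the product index `Tor N × Fin d`: `phaseM u = diagonal (p ↦ u p.1 1)`. [folklore] -/
def phaseM (u : Tor N → (ℂ →L[ℂ] ℂ)) : Matrix (Tor N × Fin d) (Tor N × Fin d) ℂ := diagonal fun p => u p.1 1

variable {N} {u : Tor N → (ℂ →L[ℂ] ℂ)} (hu : ∀ x, u x ∈ unitary (ℂ →L[ℂ] ℂ))

omit [∀ μ, NeZero (N μ)] in
/-- `(phaseM u)ᴴ = diagonal (conj phase)`. [folklore] -/
theorem phaseM_conjTranspose : (phaseM N u)ᴴ = diagonal fun p : Tor N × Fin d => conj (u p.1 1) := by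
  unfold phaseM; rw [diagonal_conjTranspose]; rfl

include hu

/-- `Uᴴ U = 1`. [folklore] -/
theorem phaseM_conjTranspose_mul : (phaseM N u)ᴴ * phaseM N u = 1 := by
  rw [phaseM_conjTranspose, phaseM, diagonal_mul_diagonal]
  have : (fun p : Tor N × Fin d => conj (u p.1 1) * u p.1 1) = fun _ => 1 := funext fun p => conj_phase_mul_phase hu p.1
  rw [this, diagonal_one]

/-- `U Uᴴ = 1`. [folklore] -/
theorem phaseM_mul_conjTranspose : phaseM N u * (phaseM N u)ᴴ = 1 := by
  rw [phaseM_conjTranspose, phaseM, diagonal_mul_diagonal]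
  have : (fun p : Tor N × Fin d => u p.1 1 * conj (u p.1 1)) = fun _ => 1 := funext fun p => phase_mul_conj_phase hu p.1
  rw [this, diagonal_one]

omit hu in
/-- **rotated 1-forms, uncurried**: `unc (gaugeW u W) = phaseM u *ᵥ unc W`. [folklore] -/
theorem unc_gaugeW (W : Tor N → Fin d → ℂ) : unc (gaugeW N u W) = phaseM N u *ᵥ unc W := by
  funext p
  rw [phaseM, mulVec_diagonal]
  exact apply_eq_phase_mul p.1 (W p.1 p.2)

/-- `cur (Uᴴ w) = gaugeW u⋆ (cur w)`. [folklore] -/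
theorem cur_conjTranspose_mulVec (w : Tor N × Fin d → ℂ) : cur ((phaseM N u)ᴴ *ᵥ w) = gaugeW N (fun x => star (u x)) (cur w) := by
  funext x μ
  show ((phaseM N u)ᴴ *ᵥ w) (x, μ) = star (u x) (w (x, μ))
  rw [phaseM_conjTranspose, mulVec_diagonal, star_apply_eq hu]

/-- `star U *ᵥ w = unc (gaugeW u⋆ (cur w))`. [folklore] -/
theorem star_mulVec_eq (w : Tor N × Fin d → ℂ) : star (phaseM N u) *ᵥ w = unc (gaugeW N (fun x => star (u x)) (cur w)) := by
  rw [star_eq_conjTranspose, ← cur_conjTranspose_mulVec hu, unc_cur]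

end PhaseMatrix

/-! ## §2 The road's matrices are conjugated -/

section Matrices

variable {N : Fin d → ℕ} [∀ μ, NeZero (N μ)] {u : Tor N → (ℂ →L[ℂ] ℂ)} (hu : ∀ x, u x ∈ unitary (ℂ →L[ℂ] ℂ))
include hu

/-- **`Kcurl (R^u) = U · Kcurl R · Uᴴ`** (both Hermitian; their forms agree by `curlSq_gauge`). [folklore] -/
theorem Kcurl_gauge (R : Tor N → Fin d → (ℂ →L[ℂ] ℂ)) :
    Kcurl N (gaugeR N u R) = phaseM N u * Kcurl N R * (phaseM N u)ᴴ := by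
  refine eq_of_forms_eq (Kcurl_posSemidef N _).1 (isHermitian_mul_mul_conjTranspose _ (Kcurl_posSemidef N R).1) fun w => ?_
  have h1 : (star w ⬝ᵥ (Kcurl N (gaugeR N u R) *ᵥ w)).re = curlSq N (gaugeR N u R) (cur w) := qform_Kcurl N _ w
  have h2 : (star w ⬝ᵥ ((phaseM N u * Kcurl N R * (phaseM N u)ᴴ) *ᵥ w)).re = curlSq N R (cur (star (phaseM N u) *ᵥ w)) := by
    rw [← star_eq_conjTranspose]
    have := qform_conj (phaseM N u) (Kcurl N R) w
    unfold qform at this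
    rw [this]
    exact qform_Kcurl N R _
  rw [h1, h2, star_mulVec_eq hu, cur_unc, ← curlSq_gauge hu R (gaugeW N (fun x => star (u x)) (cur w)), gaugeW_gaugeW_star hu]

end Matrices

section RoadMatrices

variable (n : ℕ) [NeZero n] (M : Fin d → ℕ) [hM : ∀ μ, NeZero (M μ)]
variable {v : Tor M → (ℂ →L[ℂ] ℂ)} (hv : ∀ y, v y ∈ unitary (ℂ →L[ℂ] ℂ))
variable {u : Tor (fine n M) → (ℂ →L[ℂ] ℂ)} (hu : ∀ x, u x ∈ unitary (ℂ →L[ℂ] ℂ))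

include hu in
/-- **`KV (R^u) (U Gm Uᴴ) = U · KV R Gm · Uᴴ`**. [folklore] -/
theorem KV_gauge (R : Tor (fine n M) → Fin d → (ℂ →L[ℂ] ℂ)) (Gm : Matrix (Tor (fine n M) × Fin d) (Tor (fine n M) × Fin d) ℂ) :
    KV n M (gaugeR (fine n M) u R) (phaseM (fine n M) u * Gm * (phaseM (fine n M) u)ᴴ)
      = phaseM (fine n M) u * KV n M R Gm * (phaseM (fine n M) u)ᴴ := by
  unfold KV
  rw [Kcurl_gauge hu, Matrix.mul_smul, Matrix.smul_mul, Matrix.mul_add, Matrix.add_mul, Matrix.mul_smul, Matrix.smul_mul]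

include hu in
/-- **`QmL (gaugeL v u T) = V · QmL T · Uᴴ`**. [folklore] -/
theorem QmL_gauge (T : Tor M → (Fin d → Fin n) → Fin n → Fin d → (ℂ →L[ℂ] ℂ)) :
    QmL n M (gaugeL n M v u T) = phaseM M v * QmL n M T * (phaseM (fine n M) u)ᴴ := by
  apply Matrix.toLin'.injective
  apply LinearMap.ext
  intro w
  rw [Matrix.toLin'_apply, Matrix.toLin'_apply, ← mulVec_mulVec, ← mulVec_mulVec, QmL_mulVec, QmL_mulVec, cur_conjTranspose_mulVec hu,
    ← unc_gaugeW, ← QvL_gauge n M hu (v := v) T, gaugeW_gaugeW_star hu]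

end RoadMatrices

/-! ## §3 Abstract: conjugating the effective operator -/

section Abstract

variable {ι κ : Type*} [Fintype ι] [Fintype κ] [DecidableEq ι] [DecidableEq κ]

/-- the inverse of a unitary conjugate: `(U A Uᴴ)⁻¹ = U A⁻¹ Uᴴ` (Mathlib's total `Matrix.inv`: both branches). [folklore] -/
theorem inv_conj_unitary {U : Matrix ι ι ℂ} (hU : Uᴴ * U = 1) (hU' : U * Uᴴ = 1) (A : Matrix ι ι ℂ) : (U * A * Uᴴ)⁻¹ = U * A⁻¹ * Uᴴ := by
  by_cases hA : IsUnit A.det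
  · apply inv_eq_right_inv
    calc U * A * Uᴴ * (U * A⁻¹ * Uᴴ) = U * A * (Uᴴ * U) * A⁻¹ * Uᴴ := by simp only [Matrix.mul_assoc]
      _ = U * (A * A⁻¹) * Uᴴ := by rw [hU, Matrix.mul_one, Matrix.mul_assoc U A]
      _ = 1 := by rw [mul_nonsing_inv A hA, Matrix.mul_one, hU']
  · have hdet : (U * A * Uᴴ).det = A.det := by
      rw [det_mul, det_mul, mul_comm U.det, mul_assoc, ← det_mul, hU', det_one, mul_one]
    have hA' : ¬IsUnit (U * A * Uᴴ).det := by rwa [hdet]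
    rw [nonsing_inv_apply_not_isUnit _ hA, nonsing_inv_apply_not_isUnit _ hA', Matrix.mul_zero, Matrix.zero_mul]

omit [DecidableEq ι] in
/-- `Ka (U K Uᴴ) (V Q Uᴴ) a = U · Ka K Q a · Uᴴ` (`Vᴴ V = 1`). [folklore] -/
theorem Ka_conj {U : Matrix ι ι ℂ} {V : Matrix κ κ ℂ} (hV : Vᴴ * V = 1) (K : Matrix ι ι ℂ) (Q : Matrix κ ι ℂ) (a : ℝ) :
    Ka (U * K * Uᴴ) (V * Q * Uᴴ) a = U * Ka K Q a * Uᴴ := by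
  unfold Ka
  rw [conjTranspose_mul, conjTranspose_mul, conjTranspose_conjTranspose, Matrix.mul_add, Matrix.add_mul, Matrix.mul_smul, Matrix.smul_mul]
  congr 2
  simp only [Matrix.mul_assoc]
  rw [← Matrix.mul_assoc Vᴴ V, hV, Matrix.one_mul]

/-- `Ca (U K Uᴴ) (V Q Uᴴ) a = V · Ca K Q a · Vᴴ` (`U`, `V` unitary). [folklore] -/
theorem Ca_conj {U : Matrix ι ι ℂ} {V : Matrix κ κ ℂ} (hU : Uᴴ * U = 1) (hU' : U * Uᴴ = 1) (hV : Vᴴ * V = 1) (K : Matrix ι ι ℂ) (Q : Matrix κ ι ℂ) (a : ℝ) :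
    Ca (U * K * Uᴴ) (V * Q * Uᴴ) a = V * Ca K Q a * Vᴴ := by
  unfold Ca
  rw [Ka_conj hV, inv_conj_unitary hU hU', conjTranspose_mul, conjTranspose_mul, conjTranspose_conjTranspose]
  simp only [Matrix.mul_assoc]
  rw [← Matrix.mul_assoc Uᴴ U, hU, Matrix.one_mul, ← Matrix.mul_assoc Uᴴ U, hU, Matrix.one_mul]

/-- **THE EFFECTIVE OPERATOR OF CONJUGATED DATA**: `effOp (U K Uᴴ) (V Q Uᴴ) a = V · effOp K Q a · Vᴴ` (`U`, `V` unitary). [folklore] -/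
theorem effOp_conj {U : Matrix ι ι ℂ} {V : Matrix κ κ ℂ} (hU : Uᴴ * U = 1) (hU' : U * Uᴴ = 1) (hV : Vᴴ * V = 1) (hV' : V * Vᴴ = 1)
    (K : Matrix ι ι ℂ) (Q : Matrix κ ι ℂ) (a : ℝ) :
    effOp (U * K * Uᴴ) (V * Q * Uᴴ) a = V * effOp K Q a * Vᴴ := by
  unfold effOp
  rw [Ca_conj hU hU' hV, inv_conj_unitary hV hV', Matrix.mul_sub, Matrix.sub_mul, Matrix.mul_smul, Matrix.smul_mul, Matrix.mul_one, hV']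

end Abstract

/-! ## §4 The road's effective operator -/

section Effective

variable (n : ℕ) [NeZero n] (M : Fin d → ℕ) [hM : ∀ μ, NeZero (M μ)]
variable {v : Tor M → (ℂ →L[ℂ] ℂ)} (hv : ∀ y, v y ∈ unitary (ℂ →L[ℂ] ℂ))
variable {u : Tor (fine n M) → (ℂ →L[ℂ] ℂ)} (hu : ∀ x, u x ∈ unitary (ℂ →L[ℂ] ℂ))
include hv hu

/-- **THE VECTOR EFFECTIVE OPERATOR IS GAUGE-COVARIANT** — UNCONDITIONALLY (no surjectivity ∕ coercivity hypothesis):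
`effV n M (R^u) (U Gm Uᴴ) (QmL (gaugeL v u T)) a = V · effV n M R Gm (QmL T) a · Vᴴ`, `U = phaseM (fine n M) u`, `V = phaseM M v`. [folklore] -/
theorem effV_gauge (R : Tor (fine n M) → Fin d → (ℂ →L[ℂ] ℂ)) (Gm : Matrix (Tor (fine n M) × Fin d) (Tor (fine n M) × Fin d) ℂ)
    (T : Tor M → (Fin d → Fin n) → Fin n → Fin d → (ℂ →L[ℂ] ℂ)) (a : ℝ) :
    effV n M (gaugeR (fine n M) u R) (phaseM (fine n M) u * Gm * (phaseM (fine n M) u)ᴴ) (QmL n M (gaugeL n M v u T)) a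
      = phaseM M v * effV n M R Gm (QmL n M T) a * (phaseM M v)ᴴ := by
  unfold effV
  rw [KV_gauge n M hu, QmL_gauge n M hu (v := v)]
  exact effOp_conj (phaseM_conjTranspose_mul hu) (phaseM_mul_conjTranspose hu) (phaseM_conjTranspose_mul hv) (phaseM_mul_conjTranspose hv) _ _ a

omit hv hu in
/-- the conjugated gauge matrix is PSD when `Gm` is. [folklore] -/
theorem posSemidef_conj {Gm : Matrix (Tor (fine n M) × Fin d) (Tor (fine n M) × Fin d) ℂ} (hGm : Gm.PosSemidef) :
    (phaseM (fine n M) u * Gm * (phaseM (fine n M) u)ᴴ).PosSemidef := hGm.mul_mul_conjTranspose_same _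

omit hv in
/-- the conjugated gauge matrix represents `G ∘ gaugeW u⋆`: `qform (U Gm Uᴴ) (unc W) = qform Gm (unc (gaugeW u⋆ W))`. [folklore] -/
theorem qform_conj_unc (Gm : Matrix (Tor (fine n M) × Fin d) (Tor (fine n M) × Fin d) ℂ) (W : Tor (fine n M) → Fin d → ℂ) :
    qform (phaseM (fine n M) u * Gm * (phaseM (fine n M) u)ᴴ) (unc W) = qform Gm (unc (gaugeW (fine n M) (fun x => star (u x)) W)) := by
  rw [← star_eq_conjTranspose, qform_conj, star_mulVec_eq hu, cur_unc]

omit hv in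
/-- the END's `hG` binder for the gauged data: if `G W = qform Gm (unc W)` then `G (gaugeW u⋆ W) = qform (U Gm Uᴴ) (unc W)`. [folklore] -/
theorem hG_gauge {Gm : Matrix (Tor (fine n M) × Fin d) (Tor (fine n M) × Fin d) ℂ} {G : (Tor (fine n M) → Fin d → ℂ) → ℝ}
    (hG : ∀ W, G W = qform Gm (unc W)) (W : Tor (fine n M) → Fin d → ℂ) :
    G (gaugeW (fine n M) (fun x => star (u x)) W) = qform (phaseM (fine n M) u * Gm * (phaseM (fine n M) u)ᴴ) (unc W) := by
  rw [qform_conj_unc n M hu, hG]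

end Effective

end Summit.QuantumFields.BalabanUV.T4Continuum.VectorGaugeCovariance

end
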